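import Summits.ResolutionOfSingularities.ResolutionOfSingularities.Theorems.DeltaCutSepCertificates2
import HarnessLib

/-!
# DeltaCutSepCertificates3 — decomp-res node «SepCut» (lens-6 g26, critic row 196 CLEARED +1), tree file 6/8 of the node

Content VERBATIM from the decomp-res lens-6 g26 node `HOME/decomp-res-lens-6/g26/SepCut.lean` (pin f15f025c; no
carry, imports the landed tree only); HOME = run/shared/lean/pub/decomp-res; critic row 196 CLEARED +1; landing plan
NEXT-g27.md fb3fac1c §4 + rider INBOX :1178 — provenance, critic text and the lens header in full in the first file
of the node, `DeltaCutSep`.  Namespace `…Theorems.DeltaCutClasses`; `--supports stmt-ResolutionOfSingularities-26971`.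

## This file

Continuation 3/5 of `DeltaCutSepCertificates` (same section of the node, cut at the 400-line cap): carries
`Cax_top`, `Cax_axis`, `Cax_L1_chart_t`, `Cax_L1_chart_u`, `Cax_L1_chart_z`, `Cax_L1_chart_t_noTop`,
`Cax_L1_chart_u_noTop`, `Cax_L1_chart_z_noTop`, `Cax_sepHeightOne_certificate`, `BS_charts`, `BS_L1_chart_t_top`.

[WRITER NOTE (decomp-res writer g12): file split only (tree files ≤ 400 lines); namespace, sections, section opens
and every declaration exactly as in the lens (the node's HOME-only dupNamespace-linter line is dropped; the two
namespace-level `open …TwistCutClasses` / `open …LightCutClasses` lines of the node are replayed); in the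
CERTIFICATES files the lens's five `private` helpers (`mem_of_sMul_mem_cube`, `mul_mem_pow_add`,
`not_mem_span_of_eval`, `sMul_not_mem_sq_of_pderiv_eq_one`, and `one_not_mem_prime`) lose `private` because their
users now sit in later parts of the split, and `one_not_mem_prime` — statement-identical to the LANDED
`one_not_mem_of_isPrime` of g25 `DeltaCutRunCertificates` (a `dedup.landed` restatement) — is DELETED and its 12
uses cite `one_not_mem_of_isPrime` (hence the extra import `DeltaCutRunCertificates`); likewise `mul_mem_pow_add` —
statement-identical to the LANDED `Rescue.BedZpeBinom4Centre.mul_mem_pow_add` of another hand (cone-free module;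
pre-flight `dedup.landed`) — is DELETED, that module imported and `open … (mul_mem_pow_add)` replayed in each
certificates file so the 6 uses stand verbatim.]

(Sources: Hironaka1967 (characteristic polyhedra); CossartJannsenSaito2020 Def. 3.13 / Thm. 3.14, Ch. 8, Thm. 9.6;
Hironaka1970 (near points / vertices); CossartPiltant2019 Prop. 2.6; CossartPiltant2008 §2; Giraud1975; Hironaka2005
(three key theorems: order under permissible blow-up); EGAIV4 §16–§17; StacksProject 0804 / 0BIQ / 031I; Matsumura1987 §28.)
-/

noncomputable section

open CategoryTheory CategoryTheory.Limits AlgebraicGeometry TopologicalSpace IsLocalRing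
open Literature.AlgebraicGeometry.Resolution

universe u

open Summit.ResolutionOfSingularities.ResolutionOfSingularities.Theorems.Rescue.BedZpeBinom4Centre (mul_mem_pow_add)

namespace Summit.ResolutionOfSingularities.ResolutionOfSingularities.Theorems.DeltaCutClasses

open Summit.ResolutionOfSingularities.ResolutionOfSingularities.Theorems.TwistCutClasses
open Summit.ResolutionOfSingularities.ResolutionOfSingularities.Theorems.LightCutClasses

section SepCertificates

open MvPolynomial
variable {K : Type*} [Field K]

/-! #### C_ax = `z³ + t⁴ + u⁴` (`0 = z, 1 = t, 2 = u, 3 = w`) -/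

/-- **C_ax — THE TOP LOCUS is the `w`-axis**: a prime of order `≥ 3` contains `z, t, u` (`∂_t f = 4t³`, `∂_u f = 4u³`, `z³`).
[new; elementary] [folklore] -/
theorem Cax_top [CharP K 3] (𝔮 : Ideal (MvPolynomial (Fin 4) K)) [𝔮.IsPrime] {s : MvPolynomial (Fin 4) K} (hs : s ∉ 𝔮)
    (h : s * (X 0 ^ 3 + X 1 ^ 4 + X 2 ^ 4 : MvPolynomial (Fin 4) K) ∈ 𝔮 ^ 3) :
    (X 0 : MvPolynomial (Fin 4) K) ∈ 𝔮 ∧ (X 1 : MvPolynomial (Fin 4) K) ∈ 𝔮 ∧ (X 2 : MvPolynomial (Fin 4) K) ∈ 𝔮 := by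
  have hs2 : s ^ 2 ∉ 𝔮 := pow_not_mem 𝔮 hs 2
  have h4 : (4 : MvPolynomial (Fin 4) K) ∉ 𝔮 := by
    have := natCast_not_mem (K := K) 𝔮 (m := 4) (by decide)
    exact_mod_cast this
  have e10 := f_ne K (i := 1) (j := 0) (by decide)
  have e12 := f_ne K (i := 1) (j := 2) (by decide)
  have e20 := f_ne K (i := 2) (j := 0) (by decide)
  have e21 := f_ne K (i := 2) (j := 1) (by decide)
  have e11 := f_self K 1
  have e22 := f_self K 2
  have d1 : pderiv 1 (X 0 ^ 3 + X 1 ^ 4 + X 2 ^ 4 : MvPolynomial (Fin 4) K) = 4 * X 1 ^ 3 := by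
    simp only [map_add, Derivation.leibniz_pow, smul_eq_mul, nsmul_eq_mul, e10, e11, e12]
    push_cast; ring
  have d2 : pderiv 2 (X 0 ^ 3 + X 1 ^ 4 + X 2 ^ 4 : MvPolynomial (Fin 4) K) = 4 * X 2 ^ 3 := by
    simp only [map_add, Derivation.leibniz_pow, smul_eq_mul, nsmul_eq_mul, e20, e21, e22]
    push_cast; ring
  have hX1 : (X 1 : MvPolynomial (Fin 4) K) ∈ 𝔮 := by
    have h1 := sq_mul_deriv_mem_pow 𝔮 h (pderiv 1)
    rw [d1] at h1
    exact mem_of_mul_mul_pow_mem_pow 𝔮 two_ne_zero hs2 h4 h1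
  have hX2 : (X 2 : MvPolynomial (Fin 4) K) ∈ 𝔮 := by
    have h2 := sq_mul_deriv_mem_pow 𝔮 h (pderiv 2)
    rw [d2] at h2
    exact mem_of_mul_mul_pow_mem_pow 𝔮 two_ne_zero hs2 h4 h2
  have hf : (X 0 ^ 3 + X 1 ^ 4 + X 2 ^ 4 : MvPolynomial (Fin 4) K) ∈ 𝔮 := mem_of_sMul_mem_cube 𝔮 hs h
  have hX0 : (X 0 : MvPolynomial (Fin 4) K) ∈ 𝔮 := by
    refine ‹𝔮.IsPrime›.mem_of_pow_mem 3 ?_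
    have := Ideal.sub_mem _ (Ideal.sub_mem _ hf (Ideal.pow_mem_of_mem 𝔮 hX1 4 (by norm_num)))
      (Ideal.pow_mem_of_mem 𝔮 hX2 4 (by norm_num))
    rwa [show (X 0 ^ 3 + X 1 ^ 4 + X 2 ^ 4 - X 1 ^ 4 - X 2 ^ 4 : MvPolynomial (Fin 4) K) = X 0 ^ 3 by ring] at this
  exact ⟨hX0, hX1, hX2⟩

/-- **C_ax — the `w`-axis `P = (z, t, u)` lies in the top locus** (`f ∈ P³`) and is a LINE (`w ∉ P`); with g24
`Cax_curve_certificate`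
(wild + near point at EVERY closed point of the axis) the closure of bad₀ is the whole axis `V(P)` = the top locus —
a coordinate line,
REGULAR (dictionary (R)): level 0 of the separating run is ACTIVE and step 2 is empty. [new; elementary] [folklore] -/
theorem Cax_axis :
    (X 0 ^ 3 + X 1 ^ 4 + X 2 ^ 4 : MvPolynomial (Fin 4) K) ∈ (Ideal.span {(X 0 : MvPolynomial (Fin 4) K), X 1, X 2}) ^ 3 ∧
      (X 3 : MvPolynomial (Fin 4) K) ∉ Ideal.span {(X 0 : MvPolynomial (Fin 4) K), X 1, X 2} := by
  have hX0 : (X 0 : MvPolynomial (Fin 4) K) ∈ Ideal.span {(X 0 : MvPolynomial (Fin 4) K), X 1, X 2} := Ideal.subset_span (by simp)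
  have hX1 : (X 1 : MvPolynomial (Fin 4) K) ∈ Ideal.span {(X 0 : MvPolynomial (Fin 4) K), X 1, X 2} := Ideal.subset_span (by simp)
  have hX2 : (X 2 : MvPolynomial (Fin 4) K) ∈ Ideal.span {(X 0 : MvPolynomial (Fin 4) K), X 1, X 2} := Ideal.subset_span (by simp)
  refine ⟨Ideal.add_mem _ (Ideal.add_mem _ (Ideal.pow_mem_pow hX0 3) (Ideal.pow_le_pow_right (by norm_num) (Ideal.pow_mem_pow hX1 4)))
    (Ideal.pow_le_pow_right (by norm_num) (Ideal.pow_mem_pow hX2 4)), ?_⟩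
  refine not_mem_span_of_eval _ (fun i => if i = 3 then 1 else 0) ?_ (by simp)
  intro g hg
  simp only [Set.mem_insert_iff, Set.mem_singleton_iff] at hg
  rcases hg with rfl | rfl | rfl <;> simp

/-- **C_ax, STEP 1 = blow-up of the axis `V(z, t, u)`, chart `t`**: `f(z't, t, u't, w) = t³·(z'³ + t(1 + u'⁴))`.
[new; elementary] [folklore] -/
theorem Cax_L1_chart_t :
    aeval (linChartSubst (K := K) {0, 1, 2} 1) (X 0 ^ 3 + X 1 ^ 4 + X 2 ^ 4 : MvPolynomial (Fin 4) K) =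
      X 1 ^ 3 * (X 0 ^ 3 + X 1 * (1 + X 2 ^ 4)) := by
  simp [linChartSubst]; ring

/-- chart `u`: `f(z'u, t'u, u, w) = u³·(z'³ + u(1 + t'⁴))`. [new; elementary] [folklore] -/
theorem Cax_L1_chart_u :
    aeval (linChartSubst (K := K) {0, 1, 2} 2) (X 0 ^ 3 + X 1 ^ 4 + X 2 ^ 4 : MvPolynomial (Fin 4) K) =
      X 2 ^ 3 * (X 0 ^ 3 + X 2 * (1 + X 1 ^ 4)) := by
  simp [linChartSubst]; ring

/-- chart `z`: `f(z, t'z, u'z, w) = z³·(1 + z(t'⁴ + u'⁴))`. [new; elementary] [folklore] -/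
theorem Cax_L1_chart_z :
    aeval (linChartSubst (K := K) {0, 1, 2} 0) (X 0 ^ 3 + X 1 ^ 4 + X 2 ^ 4 : MvPolynomial (Fin 4) K) =
      X 0 ^ 3 * (1 + X 0 * (X 1 ^ 4 + X 2 ^ 4)) := by
  simp [linChartSubst]; ring

/-- **C_ax, STEP 1, chart `t` — NO top point**: `z'³ + t(1 + u'⁴)` has no prime of order `≥ 3` (`∂_t` gives `1 +
u'⁴` of order `≥ 2`,
`∂_{u'}` of that: `u' ∈ 𝔮`, then `1 ∈ 𝔮`). [new; elementary] [folklore] -/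
theorem Cax_L1_chart_t_noTop [CharP K 3] (𝔮 : Ideal (MvPolynomial (Fin 4) K)) [𝔮.IsPrime] {s : MvPolynomial (Fin 4) K}
    (hs : s ∉ 𝔮) (h : s * (X 0 ^ 3 + X 1 * (1 + X 2 ^ 4) : MvPolynomial (Fin 4) K) ∈ 𝔮 ^ 3) : False := by
  have hs2 : s ^ 2 ∉ 𝔮 := pow_not_mem 𝔮 hs 2
  have hs4 : (s ^ 2) ^ 2 ∉ 𝔮 := pow_not_mem 𝔮 hs2 2
  have h4 : (4 : MvPolynomial (Fin 4) K) ∉ 𝔮 := by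
    have := natCast_not_mem (K := K) 𝔮 (m := 4) (by decide)
    exact_mod_cast this
  have e10 := f_ne K (i := 1) (j := 0) (by decide)
  have e12 := f_ne K (i := 1) (j := 2) (by decide)
  have e11 := f_self K 1
  have e22 := f_self K 2
  have d1 : pderiv 1 (X 0 ^ 3 + X 1 * (1 + X 2 ^ 4) : MvPolynomial (Fin 4) K) = 1 + X 2 ^ 4 := by
    simp only [map_add, Derivation.leibniz, Derivation.leibniz_pow, smul_eq_mul, nsmul_eq_mul, e10, e11, e12, f_one]
    push_cast; ring
  have d12 : pderiv 2 (1 + X 2 ^ 4 : MvPolynomial (Fin 4) K) = 4 * X 2 ^ 3 := by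
    simp only [map_add, Derivation.leibniz_pow, smul_eq_mul, nsmul_eq_mul, e22, f_one]
    push_cast; ring
  have h1 := sq_mul_deriv_mem_pow 𝔮 h (pderiv 1)
  rw [d1] at h1
  have hX2 : (X 2 : MvPolynomial (Fin 4) K) ∈ 𝔮 := by
    have h12 := sq_mul_deriv_mem_pow 𝔮 h1 (pderiv 2)
    rw [d12] at h12
    exact mem_of_mul_mul_pow_mem_pow 𝔮 one_ne_zero hs4 h4 h12
  have hh : (1 + X 2 ^ 4 : MvPolynomial (Fin 4) K) ∈ 𝔮 :=
    (‹𝔮.IsPrime›.mem_or_mem (Ideal.pow_le_self two_ne_zero h1)).resolve_left hs2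
  have : (1 : MvPolynomial (Fin 4) K) ∈ 𝔮 := by
    have := Ideal.sub_mem _ hh (Ideal.pow_mem_of_mem 𝔮 hX2 4 (by norm_num))
    rwa [add_sub_cancel_right] at this
  exact one_not_mem_of_isPrime 𝔮 this

/-- **C_ax, STEP 1, chart `u` — NO top point** (the `t ↔ u` mirror of `Cax_L1_chart_t_noTop`). [new; elementary] [folklore] -/
theorem Cax_L1_chart_u_noTop [CharP K 3] (𝔮 : Ideal (MvPolynomial (Fin 4) K)) [𝔮.IsPrime] {s : MvPolynomial (Fin 4) K}
    (hs : s ∉ 𝔮) (h : s * (X 0 ^ 3 + X 2 * (1 + X 1 ^ 4) : MvPolynomial (Fin 4) K) ∈ 𝔮 ^ 3) : False := by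
  have hs2 : s ^ 2 ∉ 𝔮 := pow_not_mem 𝔮 hs 2
  have hs4 : (s ^ 2) ^ 2 ∉ 𝔮 := pow_not_mem 𝔮 hs2 2
  have h4 : (4 : MvPolynomial (Fin 4) K) ∉ 𝔮 := by
    have := natCast_not_mem (K := K) 𝔮 (m := 4) (by decide)
    exact_mod_cast this
  have e20 := f_ne K (i := 2) (j := 0) (by decide)
  have e21 := f_ne K (i := 2) (j := 1) (by decide)
  have e11 := f_self K 1
  have e22 := f_self K 2
  have d2 : pderiv 2 (X 0 ^ 3 + X 2 * (1 + X 1 ^ 4) : MvPolynomial (Fin 4) K) = 1 + X 1 ^ 4 := by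
    simp only [map_add, Derivation.leibniz, Derivation.leibniz_pow, smul_eq_mul, nsmul_eq_mul, e20, e21, e22, f_one]
    push_cast; ring
  have d21 : pderiv 1 (1 + X 1 ^ 4 : MvPolynomial (Fin 4) K) = 4 * X 1 ^ 3 := by
    simp only [map_add, Derivation.leibniz_pow, smul_eq_mul, nsmul_eq_mul, e11, f_one]
    push_cast; ring
  have h2 := sq_mul_deriv_mem_pow 𝔮 h (pderiv 2)
  rw [d2] at h2
  have hX1 : (X 1 : MvPolynomial (Fin 4) K) ∈ 𝔮 := by
    have h21 := sq_mul_deriv_mem_pow 𝔮 h2 (pderiv 1)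
    rw [d21] at h21
    exact mem_of_mul_mul_pow_mem_pow 𝔮 one_ne_zero hs4 h4 h21
  have hh : (1 + X 1 ^ 4 : MvPolynomial (Fin 4) K) ∈ 𝔮 :=
    (‹𝔮.IsPrime›.mem_or_mem (Ideal.pow_le_self two_ne_zero h2)).resolve_left hs2
  have : (1 : MvPolynomial (Fin 4) K) ∈ 𝔮 := by
    have := Ideal.sub_mem _ hh (Ideal.pow_mem_of_mem 𝔮 hX1 4 (by norm_num))
    rwa [add_sub_cancel_right] at this
  exact one_not_mem_of_isPrime 𝔮 this

/-- **C_ax, STEP 1, chart `z` — NO top point**: `1 + z(t'⁴ + u'⁴)` has no prime of order `≥ 3` (`∂_z` gives `t'⁴ +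
u'⁴ ∈ 𝔮`, then
`1 ∈ 𝔮`). [new; elementary] [folklore] -/
theorem Cax_L1_chart_z_noTop (𝔮 : Ideal (MvPolynomial (Fin 4) K)) [𝔮.IsPrime] {s : MvPolynomial (Fin 4) K} (hs : s ∉ 𝔮)
    (h : s * (1 + X 0 * (X 1 ^ 4 + X 2 ^ 4) : MvPolynomial (Fin 4) K) ∈ 𝔮 ^ 3) : False := by
  have hs2 : s ^ 2 ∉ 𝔮 := pow_not_mem 𝔮 hs 2
  have e01 := f_ne K (i := 0) (j := 1) (by decide)
  have e02 := f_ne K (i := 0) (j := 2) (by decide)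
  have e00 := f_self K 0
  have d0 : pderiv 0 (1 + X 0 * (X 1 ^ 4 + X 2 ^ 4) : MvPolynomial (Fin 4) K) = X 1 ^ 4 + X 2 ^ 4 := by
    simp only [map_add, Derivation.leibniz, Derivation.leibniz_pow, smul_eq_mul, nsmul_eq_mul, e00, e01, e02, f_one]
    push_cast; ring
  have h0 := sq_mul_deriv_mem_pow 𝔮 h (pderiv 0)
  rw [d0] at h0
  have hm : (X 1 ^ 4 + X 2 ^ 4 : MvPolynomial (Fin 4) K) ∈ 𝔮 :=
    (‹𝔮.IsPrime›.mem_or_mem (Ideal.pow_le_self two_ne_zero h0)).resolve_left hs2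
  have hf : (1 + X 0 * (X 1 ^ 4 + X 2 ^ 4) : MvPolynomial (Fin 4) K) ∈ 𝔮 := mem_of_sMul_mem_cube 𝔮 hs h
  have : (1 : MvPolynomial (Fin 4) K) ∈ 𝔮 := by
    have := Ideal.sub_mem _ hf (Ideal.mul_mem_left _ (X 0) hm)
    rwa [add_sub_cancel_right] at this
  exact one_not_mem_of_isPrime 𝔮 this

/-- **C_ax — THE SEPARATING CERTIFICATE (g25 kind A at level 0; g26-DECIDED at sep-height 1).**  Level 0: top locus = the
`w`-axis (`Cax_top`, `Cax_axis`), every closed point of it bad (g24 `Cax_curve_certificate`), so `closure bad₀ = V(z,t,u)` is a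
coordinate line — REGULAR: level 0 is ACTIVE; STEP 1 blows up the axis; STEP 2 is EMPTY (`T₀ ∖ closure bad₀ = ∅`, the centre
`𝓘(∅) = ⊤` blows up to an isomorphism or is skipped — either way no new point); by dictionary (L) the three charts of the axis
blow-up carry NO point of order `3` at all: sep-level 1 has EMPTY support, hence EMPTY bad locus — `SepTerminates` at height 1,
C_ax ∈ `WORTopRunHeavySepTame 3`'s data. [new] [folklore] -/
theorem Cax_sepHeightOne_certificate [CharP K 3] :
    (∀ (𝔮 : Ideal (MvPolynomial (Fin 4) K)) [𝔮.IsPrime], ∀ s ∉ 𝔮,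
        s * (X 0 ^ 3 + X 1 ^ 4 + X 2 ^ 4 : MvPolynomial (Fin 4) K) ∈ 𝔮 ^ 3 →
          (X 0 : MvPolynomial (Fin 4) K) ∈ 𝔮 ∧ (X 1 : MvPolynomial (Fin 4) K) ∈ 𝔮 ∧ (X 2 : MvPolynomial (Fin 4) K) ∈ 𝔮) ∧
      ((X 0 ^ 3 + X 1 ^ 4 + X 2 ^ 4 : MvPolynomial (Fin 4) K) ∈ (Ideal.span {(X 0 : MvPolynomial (Fin 4) K), X 1, X 2}) ^ 3 ∧
        (X 3 : MvPolynomial (Fin 4) K) ∉ Ideal.span {(X 0 : MvPolynomial (Fin 4) K), X 1, X 2}) ∧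
      aeval (linChartSubst (K := K) {0, 1, 2} 1) (X 0 ^ 3 + X 1 ^ 4 + X 2 ^ 4 : MvPolynomial (Fin 4) K) =
        X 1 ^ 3 * (X 0 ^ 3 + X 1 * (1 + X 2 ^ 4)) ∧
      aeval (linChartSubst (K := K) {0, 1, 2} 2) (X 0 ^ 3 + X 1 ^ 4 + X 2 ^ 4 : MvPolynomial (Fin 4) K) =
        X 2 ^ 3 * (X 0 ^ 3 + X 2 * (1 + X 1 ^ 4)) ∧
      aeval (linChartSubst (K := K) {0, 1, 2} 0) (X 0 ^ 3 + X 1 ^ 4 + X 2 ^ 4 : MvPolynomial (Fin 4) K) =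
        X 0 ^ 3 * (1 + X 0 * (X 1 ^ 4 + X 2 ^ 4)) ∧
      (∀ (𝔮 : Ideal (MvPolynomial (Fin 4) K)) [𝔮.IsPrime], ∀ s ∉ 𝔮,
        s * (X 0 ^ 3 + X 1 * (1 + X 2 ^ 4) : MvPolynomial (Fin 4) K) ∈ 𝔮 ^ 3 → False) ∧
      (∀ (𝔮 : Ideal (MvPolynomial (Fin 4) K)) [𝔮.IsPrime], ∀ s ∉ 𝔮,
        s * (X 0 ^ 3 + X 2 * (1 + X 1 ^ 4) : MvPolynomial (Fin 4) K) ∈ 𝔮 ^ 3 → False) ∧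
      (∀ (𝔮 : Ideal (MvPolynomial (Fin 4) K)) [𝔮.IsPrime], ∀ s ∉ 𝔮,
        s * (1 + X 0 * (X 1 ^ 4 + X 2 ^ 4) : MvPolynomial (Fin 4) K) ∈ 𝔮 ^ 3 → False) :=
  ⟨fun 𝔮 _ _ hs h => Cax_top 𝔮 hs h, Cax_axis, Cax_L1_chart_t, Cax_L1_chart_u, Cax_L1_chart_z,
    fun 𝔮 _ _ hs h => Cax_L1_chart_t_noTop 𝔮 hs h, fun 𝔮 _ _ hs h => Cax_L1_chart_u_noTop 𝔮 hs h,
    fun 𝔮 _ _ hs h => Cax_L1_chart_z_noTop 𝔮 hs h⟩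

/-! #### B_S = `z³ + t⁷ + u⁷ + w⁷` -/

/-- **B_S — point blow-up, chart `t`**: `f(z't, t, u't, w't) = t³·(z'³ + t⁴(1 + u'⁷ + w'⁷))`; chart `z`:
`f = z³·(1 + z⁴(t'⁷ + u'⁷ + w'⁷))`; and the `S₃`-symmetry in `t, u, w` (charts `u`, `w` are chart `t` renamed).
[new; elementary] [folklore] -/
theorem BS_charts :
    aeval (chartSubst (K := K) 1) (X 0 ^ 3 + X 1 ^ 7 + X 2 ^ 7 + X 3 ^ 7 : MvPolynomial (Fin 4) K) =
        X 1 ^ 3 * (X 0 ^ 3 + X 1 ^ 4 * (1 + X 2 ^ 7 + X 3 ^ 7)) ∧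
      aeval (chartSubst (K := K) 0) (X 0 ^ 3 + X 1 ^ 7 + X 2 ^ 7 + X 3 ^ 7 : MvPolynomial (Fin 4) K) =
        X 0 ^ 3 * (1 + X 0 ^ 4 * (X 1 ^ 7 + X 2 ^ 7 + X 3 ^ 7)) ∧
      rename (Equiv.swap (1 : Fin 4) 2) (X 0 ^ 3 + X 1 ^ 7 + X 2 ^ 7 + X 3 ^ 7 : MvPolynomial (Fin 4) K) =
        X 0 ^ 3 + X 1 ^ 7 + X 2 ^ 7 + X 3 ^ 7 ∧
      rename (Equiv.swap (1 : Fin 4) 3) (X 0 ^ 3 + X 1 ^ 7 + X 2 ^ 7 + X 3 ^ 7 : MvPolynomial (Fin 4) K) =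
        X 0 ^ 3 + X 1 ^ 7 + X 2 ^ 7 + X 3 ^ 7 := by
  refine ⟨?_, ?_, ?_, ?_⟩
  · simp [chartSubst]; ring
  · simp [chartSubst]; ring
  · simp [rename_X, Equiv.swap_apply_def]; ring
  · simp [rename_X, Equiv.swap_apply_def]; ring

/-- **B_S, LEVEL 1, chart `t` — THE TOP LOCUS is the exceptional PLANE `V(z', t)`**: every prime of order `≥ 3` for
`f₁ = z'³ + t⁴·h`, `h = 1 + u'⁷ + w'⁷`, contains `z'` and `t` (`∂_{u'}`, `∂_{w'}`: `t ∈ 𝔮` or `u', w' ∈ 𝔮`; `∂_t`: `t ∈ 𝔮` or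
`h ∈ 𝔮`; `u', w', h ∈ 𝔮 ⟹ 1 ∈ 𝔮`). [new; elementary] [folklore] -/
theorem BS_L1_chart_t_top [CharP K 3] (𝔮 : Ideal (MvPolynomial (Fin 4) K)) [𝔮.IsPrime] {s : MvPolynomial (Fin 4) K}
    (hs : s ∉ 𝔮) (h : s * (X 0 ^ 3 + X 1 ^ 4 * (1 + X 2 ^ 7 + X 3 ^ 7) : MvPolynomial (Fin 4) K) ∈ 𝔮 ^ 3) :
    (X 0 : MvPolynomial (Fin 4) K) ∈ 𝔮 ∧ (X 1 : MvPolynomial (Fin 4) K) ∈ 𝔮 := by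
  have hs2 : s ^ 2 ∉ 𝔮 := pow_not_mem 𝔮 hs 2
  have h4 : (4 : MvPolynomial (Fin 4) K) ∉ 𝔮 := by
    have := natCast_not_mem (K := K) 𝔮 (m := 4) (by decide)
    exact_mod_cast this
  have h7 : (7 : MvPolynomial (Fin 4) K) ∉ 𝔮 := by
    have := natCast_not_mem (K := K) 𝔮 (m := 7) (by decide)
    exact_mod_cast this
  have e10 := f_ne K (i := 1) (j := 0) (by decide)
  have e12 := f_ne K (i := 1) (j := 2) (by decide)
  have e13 := f_ne K (i := 1) (j := 3) (by decide)
  have e20 := f_ne K (i := 2) (j := 0) (by decide)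
  have e21 := f_ne K (i := 2) (j := 1) (by decide)
  have e23 := f_ne K (i := 2) (j := 3) (by decide)
  have e30 := f_ne K (i := 3) (j := 0) (by decide)
  have e31 := f_ne K (i := 3) (j := 1) (by decide)
  have e32 := f_ne K (i := 3) (j := 2) (by decide)
  have e11 := f_self K 1
  have e22 := f_self K 2
  have e33 := f_self K 3
  have d2 : pderiv 2 (X 0 ^ 3 + X 1 ^ 4 * (1 + X 2 ^ 7 + X 3 ^ 7) : MvPolynomial (Fin 4) K) = 7 * (X 1 ^ 4 * X 2 ^ 6) ^ 1 := by
    simp only [map_add, Derivation.leibniz, Derivation.leibniz_pow, smul_eq_mul, nsmul_eq_mul, e20, e21, e22, e23, f_one]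
    push_cast; ring
  have d3 : pderiv 3 (X 0 ^ 3 + X 1 ^ 4 * (1 + X 2 ^ 7 + X 3 ^ 7) : MvPolynomial (Fin 4) K) = 7 * (X 1 ^ 4 * X 3 ^ 6) ^ 1 := by
    simp only [map_add, Derivation.leibniz, Derivation.leibniz_pow, smul_eq_mul, nsmul_eq_mul, e30, e31, e32, e33, f_one]
    push_cast; ring
  have d1 : pderiv 1 (X 0 ^ 3 + X 1 ^ 4 * (1 + X 2 ^ 7 + X 3 ^ 7) : MvPolynomial (Fin 4) K) =
      4 * (X 1 ^ 3 * (1 + X 2 ^ 7 + X 3 ^ 7)) ^ 1 := by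
    simp only [map_add, Derivation.leibniz, Derivation.leibniz_pow, smul_eq_mul, nsmul_eq_mul, e10, e11, e12, e13, f_one]
    push_cast; ring
  have hx2 : (X 1 ^ 4 * X 2 ^ 6 : MvPolynomial (Fin 4) K) ∈ 𝔮 := by
    have h' := sq_mul_deriv_mem_pow 𝔮 h (pderiv 2)
    rw [d2] at h'
    exact mem_of_mul_mul_pow_mem_pow 𝔮 two_ne_zero hs2 h7 h'
  have hx3 : (X 1 ^ 4 * X 3 ^ 6 : MvPolynomial (Fin 4) K) ∈ 𝔮 := by
    have h' := sq_mul_deriv_mem_pow 𝔮 h (pderiv 3)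
    rw [d3] at h'
    exact mem_of_mul_mul_pow_mem_pow 𝔮 two_ne_zero hs2 h7 h'
  have hx1 : (X 1 ^ 3 * (1 + X 2 ^ 7 + X 3 ^ 7) : MvPolynomial (Fin 4) K) ∈ 𝔮 := by
    have h' := sq_mul_deriv_mem_pow 𝔮 h (pderiv 1)
    rw [d1] at h'
    exact mem_of_mul_mul_pow_mem_pow 𝔮 two_ne_zero hs2 h4 h'
  have hX1 : (X 1 : MvPolynomial (Fin 4) K) ∈ 𝔮 := by
    by_contra hX1
    have hX1' : (X 1 ^ 4 : MvPolynomial (Fin 4) K) ∉ 𝔮 := pow_not_mem 𝔮 hX1 4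
    have hX1'' : (X 1 ^ 3 : MvPolynomial (Fin 4) K) ∉ 𝔮 := pow_not_mem 𝔮 hX1 3
    have hX2 : (X 2 : MvPolynomial (Fin 4) K) ∈ 𝔮 :=
      ‹𝔮.IsPrime›.mem_of_pow_mem 6 ((‹𝔮.IsPrime›.mem_or_mem hx2).resolve_left hX1')
    have hX3 : (X 3 : MvPolynomial (Fin 4) K) ∈ 𝔮 :=
      ‹𝔮.IsPrime›.mem_of_pow_mem 6 ((‹𝔮.IsPrime›.mem_or_mem hx3).resolve_left hX1')
    have hh : (1 + X 2 ^ 7 + X 3 ^ 7 : MvPolynomial (Fin 4) K) ∈ 𝔮 := (‹𝔮.IsPrime›.mem_or_mem hx1).resolve_left hX1''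
    have : (1 : MvPolynomial (Fin 4) K) ∈ 𝔮 := by
      have := Ideal.sub_mem _ (Ideal.sub_mem _ hh (Ideal.pow_mem_of_mem 𝔮 hX2 7 (by norm_num)))
        (Ideal.pow_mem_of_mem 𝔮 hX3 7 (by norm_num))
      rwa [show (1 + X 2 ^ 7 + X 3 ^ 7 - X 2 ^ 7 - X 3 ^ 7 : MvPolynomial (Fin 4) K) = 1 by ring] at this
    exact one_not_mem_of_isPrime 𝔮 this
  have hf : (X 0 ^ 3 + X 1 ^ 4 * (1 + X 2 ^ 7 + X 3 ^ 7) : MvPolynomial (Fin 4) K) ∈ 𝔮 := mem_of_sMul_mem_cube 𝔮 hs h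
  have hX0 : (X 0 : MvPolynomial (Fin 4) K) ∈ 𝔮 := by
    refine ‹𝔮.IsPrime›.mem_of_pow_mem 3 ?_
    have := Ideal.sub_mem _ hf (Ideal.mul_mem_right (1 + X 2 ^ 7 + X 3 ^ 7) _ (Ideal.pow_mem_of_mem 𝔮 hX1 4 (by norm_num)))
    rwa [add_sub_cancel_right] at this
  exact ⟨hX0, hX1⟩

end SepCertificates

end Summit.ResolutionOfSingularities.ResolutionOfSingularities.Theorems.DeltaCutClasses
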